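import Mathlib
import Summits.CriticalPhenomena.PercolationContinuityZ3.Theorems.PercNearOneGluingNoHeavyLowerTailOrientedAntipodalHallWordsTwoTriangle

/-!
# The `TYPE-t` socket: weighted two-point rows `[E ⊆ s] + t_s·[E ∩ s = ∅]` certify `MS3′` and Conjecture W2

Helper file for crux `stmt-CriticalPhenomena-4575` (`NoHeavyLowerTail`, route `PercNearOneGluingNoHeavy`),
new-inequality factory seat `prim-ineq-gen-3` (gen 19).  Everything here is PROVED; no definitions.

Gen 19 (memo `run/shared/lean/prim/prim-ineq-gen-3/CONJECTURE-TYPET.md`) replaces the instance-dependent SIGN of the gen-18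
certificates (`R3±`, `TYPE-±`: one of the two rows `[E ⊆ s]`, `[E ∩ s = ∅]` per member) by a fixed WEIGHTED combination
`u_s = [E ⊆ s] + t_s · [E ∩ s = ∅]` with one weight per TYPE (CONJECTURE `TYPE-t`: e.g. rows `z_q`, `z_p + 2 y_p`, `z_r + 3 y_r`
are linearly independent over the `MS3′` words for all pairwise disjoint `P, Q, R`; exhaustively verified on 4 points for up to 7
members and, in the labelled form, on 5 points).  This file is the elementary SOCKET consuming such a certificate, over an
arbitrary field `K` (so that certificates over `ℚ(a,b,c)` — generic weights — are covered):

* `card_le_card_of_linearIndependent_vectors` — `#D` linearly independent vectors in `K^T` force `#D ≤ #T`;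
* `card_le_card_threeFamilyWords_of_typeTCert` — weighted rows independent over the `MS3′` word family
  `(P ∪ Q) \\ (P ∪ Q) ∪ (Q ∪ R) \\ (Q ∪ R) ∪ P ⊼ R` ⟹ `#P + #Q + #R ≤ #words` (the count `MS3′` asks for);
* `card_le_card_wordsTwo_of_typeTCert` / `exists_injective_good_above_of_typeTCert` — the same for the co-good words of length two
  of a family of bads (`W2` count, and Hall via `exists_injective_good_above_of_wordsTwo`);
* `card_le_card_wordsTwo_of_transitiveTriangle_of_typeTCert` — for a transitive-triangle family the certificate on the three MEMBER
  families already gives the W2 count (via `card_le_card_wordsTwo_of_transitiveTriangle`, gen 18).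
(prim-ineq-gen-3 gen 19, 2026-08-23.)
-/

namespace Summit.CriticalPhenomena.PercolationContinuityZ3.Theorems

namespace OrientedAntipodalHall

open Finset AntipodalStrongHarris AntipodalStrongHarris.Lab
open scoped FinsetFamily

variable {α : Type*} [DecidableEq α] {k : ℕ}

omit [DecidableEq α] in
/-- **Socket (abstract form, any field).**  `#D` linearly independent vectors in `K^T` force `#D ≤ #T`. -/
theorem card_le_card_of_linearIndependent_vectors {K : Type*} [Field K] (D T : Finset (Finset α))
    (v : D → T → K) (hlin : LinearIndependent K v) : #D ≤ #T := by
  classical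
  have h := hlin.fintype_card_le_finrank
  rw [Module.finrank_fintype_fun_eq_card, Fintype.card_coe, Fintype.card_coe] at h
  exact h

/-- **`TYPE-t` socket for the three-family count `MS3′`.**  Let `P, Q, R` be pairwise disjoint families and `t` any weight
function (intended: constant on each of `P`, `Q`, `R`).  If the weighted two-point rows
`E ↦ [E ⊆ s] + t s · [E ∩ s = ∅]`, `s ∈ P ∪ Q ∪ R`, over the word family `(P ∪ Q) \\ (P ∪ Q) ∪ (Q ∪ R) \\ (Q ∪ R) ∪ P ⊼ R` are
linearly independent over a field `K`, then `#P + #Q + #R` is at most the number of such words. -/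
theorem card_le_card_threeFamilyWords_of_typeTCert {K : Type*} [Field K] (P Q R : Finset (Finset α))
    (hPQ : Disjoint P Q) (hQR : Disjoint Q R) (hPR : Disjoint P R) (t : Finset α → K)
    (hlin : LinearIndependent K (fun s : (P ∪ Q ∪ R : Finset (Finset α)) =>
      fun E : ((P ∪ Q) \\ (P ∪ Q) ∪ (Q ∪ R) \\ (Q ∪ R) ∪ P ⊼ R : Finset (Finset α)) =>
        (if (E : Finset α) ⊆ s then (1 : K) else 0) + t s * (if Disjoint (E : Finset α) s then (1 : K) else 0))) :
    #P + #Q + #R ≤ #((P ∪ Q) \\ (P ∪ Q) ∪ (Q ∪ R) \\ (Q ∪ R) ∪ P ⊼ R) := by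
  classical
  have h := card_le_card_of_linearIndependent_vectors (P ∪ Q ∪ R) _ _ hlin
  have hcard : #(P ∪ Q ∪ R) = #P + #Q + #R := by
    rw [card_union_of_disjoint (disjoint_union_left.mpr ⟨hPR, hQR⟩), card_union_of_disjoint hPQ]
  omega

/-- **`TYPE-t` socket for W2 (count).**  Let `D` be a family of bads inside `S` and `t` any weight function on `D` (intended:
one weight per type).  If the rows `G ↦ [G ⊆ S \ X] + t X · [G ⊆ X]` (member plus `t`-times bad), `G` ranging over the co-good
words of length two of `D`, are linearly independent over a field `K`, then `#D` is at most the number of such words. -/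
theorem card_le_card_wordsTwo_of_typeTCert {K : Type*} [Field K] (S : Finset α) (f : Finset α → Lab k)
    (D : Finset (Finset α)) (t : Finset α → K)
    (hlin : LinearIndependent K (fun X : D => fun G : ({G ∈ S.powerset | f G = bot ∧ f (S \ G) = top ∧
        ∃ X ∈ D, ∃ Y ∈ D, G = (S \ X) \ (S \ Y) ∨ G = (S \ X) ∩ (S \ Y)} : Finset (Finset α)) =>
        (if (G : Finset α) ⊆ S \ X then (1 : K) else 0) + t X * (if (G : Finset α) ⊆ X then (1 : K) else 0))) :
    #D ≤ #{G ∈ S.powerset | f G = bot ∧ f (S \ G) = top ∧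
      ∃ X ∈ D, ∃ Y ∈ D, G = (S \ X) \ (S \ Y) ∨ G = (S \ X) ∩ (S \ Y)} :=
  card_le_card_of_linearIndependent_vectors D _ _ hlin

/-- **`TYPE-t` certificates on all sub-families give Hall.**  If every sub-family `D'` of `D` admits weights whose weighted
two-point rows over the co-good words of length two of `D'` are linearly independent (over a fixed field `K`), then `D` has
distinct good representatives. -/
theorem exists_injective_good_above_of_typeTCert {K : Type*} [Field K] (S : Finset α) {f : Finset α → Lab k}
    (D : Finset (Finset α)) (hDS : ∀ X ∈ D, X ⊆ S)
    (hcert : ∀ D' ⊆ D, ∃ t : Finset α → K,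
      LinearIndependent K (fun X : D' => fun G : ({G ∈ S.powerset | f G = bot ∧ f (S \ G) = top ∧
        ∃ X ∈ D', ∃ Y ∈ D', G = (S \ X) \ (S \ Y) ∨ G = (S \ X) ∩ (S \ Y)} : Finset (Finset α)) =>
        (if (G : Finset α) ⊆ S \ X then (1 : K) else 0) + t X * (if (G : Finset α) ⊆ X then (1 : K) else 0))) :
    ∃ φ : D → Finset α, Function.Injective φ ∧
      ∀ X : D, (X : Finset α) ⊆ φ X ∧ φ X ⊆ S ∧ f (φ X) = top ∧ f (S \ φ X) = bot := by
  refine exists_injective_good_above_of_wordsTwo S D hDS fun D' hD' => ?_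
  obtain ⟨t, ht⟩ := hcert D' hD'
  exact card_le_card_wordsTwo_of_typeTCert S f D' t ht

/-- **Transitive triangle: a `TYPE-t` certificate on the MEMBER families gives the W2 count.**  `D₁, D₂, D₃` bads of types
`(a,b)`, `(a,c)`, `(b,c)` inside `S` (`a, b, c` distinct, `f` monotone), `Mᵢ = {S \ X : X ∈ Dᵢ}` the member families.  If weighted
two-point rows of `M₁ ∪ M₂ ∪ M₃` over the `MS3′` words `(M₁ ∪ M₂) \\ (M₁ ∪ M₂) ∪ (M₂ ∪ M₃) \\ (M₂ ∪ M₃) ∪ M₁ ⊼ M₃` are linearly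
independent, then the co-good words of length two of `D₁ ∪ D₂ ∪ D₃` number at least `#D₁ + #D₂ + #D₃`. -/
theorem card_le_card_wordsTwo_of_transitiveTriangle_of_typeTCert {K : Type*} [Field K] (S : Finset α)
    {f : Finset α → Lab k} (hf : ∀ ⦃U V : Finset α⦄, U ⊆ V → f U ≤ f V) (D₁ D₂ D₃ : Finset (Finset α)) {a b c : Fin k}
    (hab : a ≠ b) (hac : a ≠ c) (hbc : b ≠ c)
    (h₁S : ∀ X ∈ D₁, X ⊆ S) (h₁i : ∀ X ∈ D₁, f X = petal a) (h₁j : ∀ X ∈ D₁, f (S \ X) = petal b)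
    (h₂S : ∀ Y ∈ D₂, Y ⊆ S) (h₂i : ∀ Y ∈ D₂, f Y = petal a) (h₂j : ∀ Y ∈ D₂, f (S \ Y) = petal c)
    (h₃S : ∀ Z ∈ D₃, Z ⊆ S) (h₃i : ∀ Z ∈ D₃, f Z = petal b) (h₃j : ∀ Z ∈ D₃, f (S \ Z) = petal c)
    (t : Finset α → K)
    (hlin : LinearIndependent K
      (fun s : ((D₁.image fun X => S \ X) ∪ (D₂.image fun X => S \ X) ∪ (D₃.image fun X => S \ X) : Finset (Finset α)) =>
      fun E : (((D₁.image fun X => S \ X) ∪ (D₂.image fun X => S \ X)) \\ ((D₁.image fun X => S \ X) ∪ (D₂.image fun X => S \ X)) ∪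
        ((D₂.image fun X => S \ X) ∪ (D₃.image fun X => S \ X)) \\ ((D₂.image fun X => S \ X) ∪ (D₃.image fun X => S \ X)) ∪
        (D₁.image fun X => S \ X) ⊼ (D₃.image fun X => S \ X) : Finset (Finset α)) =>
        (if (E : Finset α) ⊆ s then (1 : K) else 0) + t s * (if Disjoint (E : Finset α) s then (1 : K) else 0))) :
    #D₁ + #D₂ + #D₃ ≤ #{G ∈ S.powerset | f G = bot ∧ f (S \ G) = top ∧
      ∃ X ∈ D₁ ∪ D₂ ∪ D₃, ∃ Y ∈ D₁ ∪ D₂ ∪ D₃, G = (S \ X) \ (S \ Y) ∨ G = (S \ X) ∩ (S \ Y)} := by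
  classical
  refine card_le_card_wordsTwo_of_transitiveTriangle S hf D₁ D₂ D₃ hab hac hbc h₁S h₁i h₁j h₂S h₂i h₂j h₃S h₃i h₃j ?_
  set M₁ : Finset (Finset α) := D₁.image fun X => S \ X with hM₁
  set M₂ : Finset (Finset α) := D₂.image fun X => S \ X with hM₂
  set M₃ : Finset (Finset α) := D₃.image fun X => S \ X with hM₃
  -- complementation inside `S` is injective on each class, so `#Mᵢ = #Dᵢ`
  have hinj : ∀ D : Finset (Finset α), (∀ X ∈ D, X ⊆ S) → #(D.image fun X => S \ X) = #D := by
    intro D hDS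
    refine card_image_of_injOn ?_
    intro X hX X' hX' h
    have e₁ := Finset.sdiff_sdiff_eq_self (hDS X hX)
    have e₂ := Finset.sdiff_sdiff_eq_self (hDS X' hX')
    simp only at h
    rw [← e₁, ← e₂, h]
  -- a member of one class is never a member of another class (its label or its complement's label differ)
  have hne₁₂ : ∀ X ∈ D₁, ∀ Y ∈ D₂, S \ X ≠ S \ Y := by
    intro X hX Y hY h
    have := (h₁j X hX).symm.trans (h ▸ h₂j Y hY)
    exact hbc (Lab.petal.inj this)
  have hne₂₃ : ∀ Y ∈ D₂, ∀ Z ∈ D₃, S \ Y ≠ S \ Z := by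
    intro Y hY Z hZ h
    have e₁ := Finset.sdiff_sdiff_eq_self (h₂S Y hY)
    have e₂ := Finset.sdiff_sdiff_eq_self (h₃S Z hZ)
    have hYZ : Y = Z := by rw [← e₁, ← e₂, h]
    have := (h₂i Y hY).symm.trans (hYZ ▸ h₃i Z hZ)
    exact hab (Lab.petal.inj this)
  have hne₁₃ : ∀ X ∈ D₁, ∀ Z ∈ D₃, S \ X ≠ S \ Z := by
    intro X hX Z hZ h
    have := (h₁j X hX).symm.trans (h ▸ h₃j Z hZ)
    exact hbc (Lab.petal.inj this)
  have hdisj : ∀ (Da Db : Finset (Finset α)), (∀ X ∈ Da, ∀ Y ∈ Db, S \ X ≠ S \ Y) →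
      Disjoint (Da.image fun X => S \ X) (Db.image fun X => S \ X) := by
    intro Da Db hne
    rw [Finset.disjoint_left]
    intro C hCa hCb
    obtain ⟨X, hX, rfl⟩ := mem_image.mp hCa
    obtain ⟨Y, hY, hYX⟩ := mem_image.mp hCb
    exact hne X hX Y hY hYX.symm
  have h := card_le_card_threeFamilyWords_of_typeTCert M₁ M₂ M₃ (hdisj D₁ D₂ hne₁₂) (hdisj D₂ D₃ hne₂₃)
    (hdisj D₁ D₃ hne₁₃) t hlin
  rw [hinj D₁ h₁S, hinj D₂ h₂S, hinj D₃ h₃S] at h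
  exact h

end OrientedAntipodalHall

end Summit.CriticalPhenomena.PercolationContinuityZ3.Theorems
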